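import Literature.Barriers.ValiantsHypothesis.CT23ExplicitDeterminantABP
import HarnessLib

/-!
# All coefficients of the characteristic polynomial as entries of ONE power of ONE explicit matrix
# (Mahajan–Vinay's layered clow program read at every layer; Mahajan–Vinay 1997 Thm. 1 /
# Mahajan–Vinay 1999 Thm. 3.2 in explicit-matrix form; val-lit t20 g10)

Theorem-only (plus plumbing `def`s) companion of
`Literature/Barriers/ValiantsHypothesis/CT23ExplicitDeterminantABP.lean` (val-lit t24 g9: the
DETERMINANT as the `(source, sink)` entry of a power of one explicitly given matrix) and of the
tree's signed clow dynamics `Literature/Computability/AlgebraicComplexity/SymmetricDetRepresentationProofs.lean`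
(`GKKP2011.sv`, `GKKP2011.e`, `GKKP2011.sv_spec`) / `IL17LayeredDetProgram.lean` (`IL17.fullN`,
`IL17.fullSrc`, `IL17.fullSnk`, `IL17.fullSrc_vecMul_pow`). NO named facts. Honest framing: classical
division-free linear algebra (1997/1999), typed and proved; it discharges nothing by itself and
nothing here bears on `VP` versus `VNP` (NOT proved).

## The printed statement

Mahajan–Vinay, *Determinant: Old Algorithms, New Insights*, SIAM J. Discrete Math. 12 (1999),
held text `paper:doi-10-1137-s0895480198338827`:

* p0003.txt:L46–47: "`χ_A(λ) = det(λI_n − A) = c_0 λ^n + c_1 λ^{n−1} + ⋯ + c_{n−1} λ + c_n`."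
* Def. 3.1 (p0004.txt:L42–52): clows (closed walks whose least vertex, the head, is visited once),
  `l`-clow sequences `C = ⟨C_1, …, C_k⟩` (heads strictly increasing, `l` edges in total),
  `wt(C) = ∏ w(C_j)`, `sgn(C) = (−1)^{l+k}`.
* **Thm. 3.2** (p0005.txt:L20–27; "see [15, Theorem 1]" = Mahajan–Vinay, Chicago J. TCS 1997,
  Thm. 1): "`c_l = (−1)^l Σ_{C an l-clow sequence} sgn(C) wt(C)`" — i.e. `c_l` is the sum over the
  `l`-clow sequences of `(−1)^{#clows} · wt`, EVERY coefficient by the same signed count, graded by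
  the number `l` of edges.
* §3.1 "Algorithm using clow sequences" (p0006.txt:L11–47): the contributions are summed by a
  layered dynamic programme over (number of edges so far, head, current vertex) — the branching
  program whose adjacency matrix, for `l = n` (the determinant), is CT23's Claim 2.30 and the
  tree's `IL17.fullN` / t24's `mvAdjGen`.

## Rendering (what is proved)

The tree's dynamics is ALREADY graded in the clow length: `GKKP2011.e t d = [X^{t−d}] χ(M_t)` for
every `d` (the signed weighted number of clow sequences with `d` edges on the vertices `< t`,
Berkowitz orientation: heads = largest vertex, increasing), and `GKKP2011.sv_spec` says that after
`d` edges the closed head `(t, t)` carries `e (t+1) d − e t d`. Summing over the heads telescopes: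

* `GKKP2011.sum_range_sv_diag` / **`GKKP2011.sum_range_sv_diag_eq_coeff`**: for `1 ≤ d ≤ N`,
  `Σ_{t<N} sv d t t = [X^{N−d}] χ(X)` for the generic `N × N` matrix `X` — Thm. 3.2 for every `l = d`
  in the tree's dynamics (the tree's `GKKP2011.sum_sv_diag` is the case `d = N`).

We then package ALL coefficients into ONE square matrix, exactly as t24 g9 did for the
determinant, so that a SINGLE power `A^P` (`P ≥ N`, e.g. a power of two reached by repeated
squaring) exhibits every coefficient as one of its entries:

* States `CState n = source ⊕ IL17.LState n ⊕ Fin (n+3)` (`N = n + 2 ≥ 2`): t24's `MVState n`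
  with `N + 1` sinks `snk d`, `d = 0, …, N`, instead of one.
* **`mvCharAdjGen k n`** (generic matrix `(X_{ij})_{i,j<N}`) / **`mvCharAdj M`** (any
  `M : Matrix (Fin (n+2)) (Fin (n+2)) R`, `R` a commutative ring): source → layer `0` by
  `IL17.fullSrc` (the first edge opens the first clow); layer `i` → layer `i + 1` by the transfer
  matrix `GKKP2011.T₀` ITSELF (`IL17.fullN`; NO extra sign — unlike t24's determinant matrix, whose
  internal layers carry `−T₀` to turn `[X⁰]χ` into `det`; here the targets ARE the coefficients of
  `χ(λ) = det(λI − M)`); source → `snk 0` with weight `1` (the empty clow sequence, `c_0 = 1`);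
  layer `d − 1`'s CLOSED heads `(t, t)` → `snk d` with weight `1` for `1 ≤ d ≤ N − 1`; layer
  `N − 2` → `snk N` by `IL17.fullSnk` (the last edge closes the last clow at the head `N − 1`, as in
  the determinant program); a unit self-loop at every sink.
* **`mvCharAdjGen_pow_src_snk`** / **`mvCharAdj_pow_src_snk`**: for every `P ≥ n + 2` and every
  `d : Fin (n+3)`, `(A^P) source (snk d) = [X^{N−d}] χ`, i.e. `= M.charpoly.coeff (n + 2 − d)`
  (Mathlib's `Matrix.charpoly M = det(X·1 − M)`, the printed `χ_A`; so `snk d` carries the printed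
  `c_d`, in particular `snk N` carries `c_N = (−1)^N det M` and `snk 0` carries `c_0 = 1`).
* Closed-form entries of `mvCharAdj M` by index tests and ONE entry of `M` (t24's `transN`,
  `entryN`, `selW`, imported by name): `mvCharAdj_src_mid`, `mvCharAdj_mid_mid`,
  `mvCharAdj_src_snk`, `mvCharAdj_mid_snk`, `mvCharAdj_snk_snk`, `mvCharAdj_apply_src`,
  `mvCharAdj_snk_mid` — the shape a space-bounded / succinct evaluator consumes (val-lit KV20
  M1-programme memo `HOME/np/MEMO-x5g6-KV20-M1-programme.md`, step (P3): "charpoly coefficients of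
  a succinct matrix = iterated matrix product of a succinct matrix"; this file is the
  interpolation-free alternative to the route noted there at 14:40Z).

Route disclosure: the printed proof of Thm. 3.2 is a sign-reversing involution on clow sequences;
the tree's (and this file's) route is algebraic — Berkowitz's recursion `Berkowitz.chi_succ_coeff`
⇒ the graded invariants `GKKP2011.sv_spec` (Soltys 2002 §3 reading of Berkowitz by clow
sequences) — and the orientation is Berkowitz's (heads = largest vertex). The STATEMENT proved is
the printed one for every coefficient: `c_d` = the value of the `d`-edge layer of the signed clow
program, all `d` at once from one matrix power.

## Main declarations (namespace `Literature.Computability.AlgebraicComplexity`)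

* `GKKP2011.sum_range_sv_diag`, `GKKP2011.sum_range_sv_diag_eq_coeff`, `GKKP2011.sum_univ_sv_diag_eq_coeff`.
* `CState`, `CState.src/mid/snk`, `snkW`, `mvCharAdjGen`, `sinkIn`, `csrcRow`,
  `mvCharAdjGen_pow_src`, `sinkIn_zero_right`, `sinkIn_mid_range`, `sinkIn_last`,
  **`mvCharAdjGen_pow_src_snk`**.
* `mvCharAdj`, **`mvCharAdj_pow_src_snk`**, `mvCharAdj_src_mid`, `mvCharAdj_mid_mid`,
  `mvCharAdj_src_snk`, `mvCharAdj_mid_snk`, `mvCharAdj_snk_snk`, `mvCharAdj_apply_src`,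
  `mvCharAdj_snk_mid`, `mvCharAdj_pow_src_snk_last` (`snk N` carries `(−1)^N det M`),
  `mvCharAdj_pow_src_snk_zero` (`snk 0` carries `1`).

## References

* [MahajanVinay1999] M. Mahajan, V. Vinay, *Determinant: Old Algorithms, New Insights*, SIAM J.
  Discrete Math. 12 (1999) 474–490 — Def. 3.1 (p0004.txt:L42–52), **Thm. 3.2** (p0005.txt:L20–27),
  §3.1 layered algorithm (p0006.txt:L11–47); held text `paper:doi-10-1137-s0895480198338827`.
* [MahajanVinay1997] M. Mahajan, V. Vinay, *Determinant: combinatorics, algorithms, and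
  complexity*, Chicago J. Theoret. Comput. Sci. 1997, Thm. 1 (= [MahajanVinay1999, Thm. 3.2]).
* [Soltys2002] M. Soltys, *Berkowitz's algorithm and clow sequences*, Electron. J. Linear Algebra
  9 (2002) 42–54, §3 (the route of `GKKP2011.sv_spec`).
* [ChatterjeeTengse2023] P. Chatterjee, A. Tengse, arXiv:2309.07612, Claim 2.30 (v1 Claim 37):
  the one-matrix packaging for the determinant (`CT23ExplicitDeterminantABP.lean`, t24 g9).
* [IkenmeyerLandsberg2017] C. Ikenmeyer, J. M. Landsberg, JPAA 221 (2017), Prop. 3.2 (the layered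
  program `IL17.fullN`).
-/

noncomputable section

open MvPolynomial

namespace Literature.Computability.AlgebraicComplexity

open _root_.Matrix Finset Berkowitz GKKP2011 IL17
open Literature.Barriers.ValiantsHypothesis

universe u

/-! ## Part 0. Mahajan–Vinay Thm. 3.2 in the tree's dynamics: every coefficient, by telescoping -/

namespace GKKP2011

variable {k : Type u} [CommRing k] {n : ℕ}

/-- After `d` edges the closed heads carry in total `e n d − e 0 d` (telescoping the invariant
`sv d t t = e (t+1) d − e t d` of `GKKP2011.sv_spec`). [cite: MahajanVinay1999, Thm. 3.2 (p0005.txt:L20–27)] -/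
theorem sum_range_sv_diag (d : ℕ) :
    ∑ t ∈ range n, sv k n d t t = e k n n d - e k n 0 d := by
  simp_rw [(sv_spec (k := k) (n := n) d).2.1]
  exact Finset.sum_range_sub (fun t' => e k n t' d) n

/-- **Mahajan–Vinay 1999 Thm. 3.2 / 1997 Thm. 1, every coefficient** (tree dynamics, generic
matrix `X = (X_{ij})_{i,j<n}`): for `1 ≤ d ≤ n` the signed weighted number of clow sequences with
`d` edges — the total mass of the closed heads after `d` edges — is the coefficient
`[λ^{n−d}] χ_X(λ)` (the printed `c_d`). [cite: MahajanVinay1999, Thm. 3.2 (p0005.txt:L20–27)] -/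
theorem sum_range_sv_diag_eq_coeff {d : ℕ} (hd : 1 ≤ d) (hdn : d ≤ n) :
    ∑ t ∈ range n, sv k n d t t = (chi k n n).coeff (n - d) := by
  rw [sum_range_sv_diag, e_zero_left, if_neg (by omega), sub_zero]
  unfold e
  rw [if_pos hdn]

/-- The same over `Fin n`. [cite: MahajanVinay1999, Thm. 3.2 (p0005.txt:L20–27)] -/
theorem sum_univ_sv_diag_eq_coeff {d : ℕ} (hd : 1 ≤ d) (hdn : d ≤ n) :
    ∑ t : Fin n, sv k n d t t = (chi k n n).coeff (n - d) := by
  rw [Fin.sum_univ_eq_sum_range (fun t => sv k n d t t) n]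
  exact sum_range_sv_diag_eq_coeff hd hdn

end GKKP2011

/-! ## Part A. One square matrix whose powers exhibit every coefficient (generic matrix) -/

section Program

variable (k : Type u) [CommRing k] (n : ℕ)

/-- The vertices of the all-coefficients program for `(n+2) × (n+2)` matrices: the source, the
layered states `(i, (t, u))` of `IL17.LState n` (`i ≤ n` = number of internal edges so far, `t` the
head and `u` the current vertex of the open clow, `u = t` = that clow has just been closed), and
`n + 3` sinks `snk d`, `d = 0, …, n + 2`, one per coefficient `c_d`.
[cite: MahajanVinay1999, §3.1 (p0006.txt:L11–47)] -/
abbrev CState : Type := Unit ⊕ LState n ⊕ Fin (n + 3)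

/-- The source vertex. [cite: MahajanVinay1999, §3.1 (p0006.txt:L11–47)] -/
abbrev CState.src : CState n := Sum.inl ()
/-- An internal vertex `(layer, (head, current))`. [cite: MahajanVinay1999, §3.1 (p0006.txt:L11–47)] -/
abbrev CState.mid (p : LState n) : CState n := Sum.inr (Sum.inl p)
/-- The sink collecting the coefficient `c_d`. [cite: MahajanVinay1999, §3.1 (p0006.txt:L11–47)] -/
abbrev CState.snk (d : Fin (n + 3)) : CState n := Sum.inr (Sum.inr d)

open CState

/-- The edges into the sinks: `snk (n+2)` receives the last closing edge from the last layer
(`IL17.fullSnk`, exactly as the determinant program); `snk d` for `1 ≤ d ≤ n + 1` receives, with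
weight `1`, the CLOSED heads `(t, t)` of the layer `d − 1` (the states reached after `d` edges);
`snk 0` receives nothing from the layers (it is fed by the source).
[cite: MahajanVinay1999, Thm. 3.2 and §3.1 (p0005.txt:L20–27, p0006.txt:L11–47)] -/
def snkW (p : LState n) (d : Fin (n + 3)) : MvPolynomial (Fin (n + 2) × Fin (n + 2)) k :=
  if (d : ℕ) = n + 2 then fullSnk k n p
  else if (p.1 : ℕ) + 1 = d ∧ p.2.2 = p.2.1 then 1 else 0

/-- **The adjacency matrix of the all-coefficients Mahajan–Vinay program** for the GENERIC matrix
`(X_{ij})_{i,j < n+2}` (Berkowitz orientation, the tree's `GKKP2011.T₀` / `IL17.fullN`): source →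
layer `0` by `IL17.fullSrc`; layer `i` → layer `i + 1` by the signed transfer matrix itself
(continue the clow `X_{uv}` / close it `−X_{ut}` / open the next head); source → `snk 0` with
weight `1`; layers → sinks by `snkW`; a unit self-loop at every sink (padding: every source–sink
walk of length `≥ n + 2` is a source–sink path followed by loops).
[cite: MahajanVinay1999, Thm. 3.2 and §3.1 (p0005.txt:L20–27, p0006.txt:L11–47)] -/
def mvCharAdjGen : Matrix (CState n) (CState n) (MvPolynomial (Fin (n + 2) × Fin (n + 2)) k) :=
  Matrix.of fun x y =>
    match x, y with
    | Sum.inl _, Sum.inr (Sum.inl q) => fullSrc k n q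
    | Sum.inl _, Sum.inr (Sum.inr d) => if (d : ℕ) = 0 then 1 else 0
    | Sum.inr (Sum.inl p), Sum.inr (Sum.inl q) => fullN k n p q
    | Sum.inr (Sum.inl p), Sum.inr (Sum.inr d) => snkW k n p d
    | Sum.inr (Sum.inr d), Sum.inr (Sum.inr d') => if d = d' then 1 else 0
    | _, _ => 0

/-- The mass entering the sink `d` at the `(m+1)`-st step: from the source when `m = 0` (only into
`snk 0`), otherwise from the layer states carrying `fullSrc · fullN^{m−1}`.
[cite: MahajanVinay1999, §3.1 (p0006.txt:L11–47)] -/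
def sinkIn (m : ℕ) (d : Fin (n + 3)) : MvPolynomial (Fin (n + 2) × Fin (n + 2)) k :=
  if m = 0 then (if (d : ℕ) = 0 then 1 else 0)
  else ∑ q : LState n, (fullSrc k n ᵥ* fullN k n ^ (m - 1)) q * snkW k n q d

/-- The source row of the `m`-th power, in closed form: nothing returns to the source, layer states
carry `fullSrc · fullN^{m−1}`, and the sink `d` accumulates `sinkIn j d` over `j < m`.
[cite: MahajanVinay1999, §3.1 (p0006.txt:L11–47)] -/
def csrcRow (m : ℕ) : CState n → MvPolynomial (Fin (n + 2) × Fin (n + 2)) k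
  | Sum.inl _ => if m = 0 then 1 else 0
  | Sum.inr (Sum.inl q) => if m = 0 then 0 else (fullSrc k n ᵥ* fullN k n ^ (m - 1)) q
  | Sum.inr (Sum.inr d) => ∑ j ∈ range m, sinkIn k n j d

variable {k n}

/-- **The source row of `A^m`.** [cite: MahajanVinay1999, §3.1 (p0006.txt:L11–47)] -/
theorem mvCharAdjGen_pow_src (m : ℕ) (y : CState n) :
    (mvCharAdjGen k n ^ m) (src n) y = csrcRow k n m y := by
  induction m generalizing y with
  | zero =>
    rcases y with ⟨⟨⟩⟩ | ⟨q | d⟩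
    · simp [csrcRow]
    · simp [csrcRow]
    · simp [csrcRow]
  | succ m ih =>
    rw [pow_succ, Matrix.mul_apply]
    simp_rw [ih]
    rw [Fintype.sum_sum_type, Fintype.sum_sum_type]
    simp only [Finset.univ_unique, Finset.sum_singleton]
    have h0 : ∀ x : CState n, mvCharAdjGen k n x (Sum.inl PUnit.unit) = 0 := by
      rintro (⟨⟨⟩⟩ | ⟨p | d⟩) <;> rfl
    have h1 : ∀ q : LState n,
        mvCharAdjGen k n (Sum.inl PUnit.unit) (Sum.inr (Sum.inl q)) = fullSrc k n q := fun q => rfl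
    have h2 : ∀ p q : LState n,
        mvCharAdjGen k n (Sum.inr (Sum.inl p)) (Sum.inr (Sum.inl q)) = fullN k n p q := fun p q => rfl
    have h3 : ∀ (d : Fin (n + 3)) (q : LState n),
        mvCharAdjGen k n (Sum.inr (Sum.inr d)) (Sum.inr (Sum.inl q)) = 0 := fun d q => rfl
    have h4 : ∀ d : Fin (n + 3), mvCharAdjGen k n (Sum.inl PUnit.unit) (Sum.inr (Sum.inr d)) =
        if (d : ℕ) = 0 then 1 else 0 := fun d => rfl
    have h5 : ∀ (p : LState n) (d : Fin (n + 3)),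
        mvCharAdjGen k n (Sum.inr (Sum.inl p)) (Sum.inr (Sum.inr d)) = snkW k n p d := fun p d => rfl
    have h6 : ∀ d d' : Fin (n + 3), mvCharAdjGen k n (Sum.inr (Sum.inr d)) (Sum.inr (Sum.inr d')) =
        if d = d' then 1 else 0 := fun d d' => rfl
    have hsrc : csrcRow k n m (Sum.inl PUnit.unit) = if m = 0 then 1 else 0 := rfl
    have hmid : ∀ x : LState n, csrcRow k n m (Sum.inr (Sum.inl x)) =
        if m = 0 then 0 else (fullSrc k n ᵥ* fullN k n ^ (m - 1)) x := fun _ => rfl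
    have hsnk : ∀ x : Fin (n + 3), csrcRow k n m (Sum.inr (Sum.inr x)) =
        ∑ j ∈ range m, sinkIn k n j x := fun _ => rfl
    rcases y with ⟨⟨⟩⟩ | ⟨q | d⟩
    · -- into the source: no edges
      simp [h0, csrcRow]
    · -- into a layer state
      simp only [h1, h2, h3, mul_zero, Finset.sum_const_zero, add_zero, csrcRow]
      obtain _ | m := m
      · simp
      · simp only [Nat.succ_ne_zero, ↓reduceIte, zero_mul, zero_add, Nat.add_sub_cancel, pow_succ,
          ← Matrix.vecMul_vecMul]
        rfl
    · -- into a sink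
      rw [show csrcRow k n (m + 1) (Sum.inr (Sum.inr d)) = ∑ j ∈ range (m + 1), sinkIn k n j d
        from rfl, Finset.sum_range_succ, h4, hsrc]
      simp_rw [h5, h6, hmid, hsnk]
      have hloop : ∑ x : Fin (n + 3), (∑ j ∈ range m, sinkIn k n j x) * (if x = d then 1 else 0) =
          ∑ j ∈ range m, sinkIn k n j d := by
        simp_rw [mul_ite, mul_one, mul_zero]
        rw [Finset.sum_ite_eq', if_pos (Finset.mem_univ _)]
      rw [hloop]
      obtain _ | m := m
      · have hs : sinkIn k n 0 d = if (d : ℕ) = 0 then 1 else 0 := by simp [sinkIn]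
        rw [hs]
        simp
      · have hs : sinkIn k n (m + 1) d =
            ∑ q : LState n, (fullSrc k n ᵥ* fullN k n ^ m) q * snkW k n q d := by
          simp [sinkIn]
        rw [hs]
        simp only [Nat.succ_ne_zero, ↓reduceIte, zero_mul, zero_add, Nat.add_sub_cancel]
        exact add_comm _ _

/-- Exactly one index of `Fin m` has value `d` when `d < m`, none otherwise. [folklore] -/
private theorem sum_fin_val_eq' {M : Type*} [AddCommMonoid M] (m d : ℕ) (c : M) :
    ∑ i : Fin m, (if (i : ℕ) = d then c else 0) = if d < m then c else 0 := by
  by_cases hd : d < m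
  · rw [if_pos hd]
    have h : ∀ i : Fin m, ((i : ℕ) = d) = (i = ⟨d, hd⟩) := fun i => by rw [Fin.ext_iff]
    simp_rw [h]
    rw [Finset.sum_ite_eq', if_pos (Finset.mem_univ _)]
  · rw [if_neg hd]
    exact Finset.sum_eq_zero fun i _ => if_neg (by have := i.isLt; omega)

/-- Nothing from the layers enters `snk 0`; the source feeds it `1` at the first step.
[cite: MahajanVinay1999, Thm. 3.2 (p0005.txt:L20–27), `c_0 = 1`] -/
theorem sinkIn_zero_right (m : ℕ) (d : Fin (n + 3)) (hd : (d : ℕ) = 0) :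
    sinkIn k n m d = if m = 0 then 1 else 0 := by
  unfold sinkIn
  by_cases hm : m = 0
  · rw [if_pos hm, if_pos hd, if_pos hm]
  · rw [if_neg hm, if_neg hm]
    refine Finset.sum_eq_zero fun q _ => ?_
    rw [snkW, if_neg (by omega), if_neg (by omega), mul_zero]

/-- **The middle sinks**: for `1 ≤ d ≤ n + 1` the mass entering `snk d` at step `m + 1` is the total
mass of the closed heads after `d` edges when `m = d`, i.e. the coefficient `[λ^{N−d}] χ_X`, and
nothing otherwise. [cite: MahajanVinay1999, Thm. 3.2 (p0005.txt:L20–27)] -/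
theorem sinkIn_mid_range (m : ℕ) (d : Fin (n + 3)) (hd1 : 1 ≤ (d : ℕ)) (hd2 : (d : ℕ) ≤ n + 1) :
    sinkIn k n m d = if m = d then (chi k (n + 2) (n + 2)).coeff (n + 2 - d) else 0 := by
  unfold sinkIn
  by_cases hm : m = 0
  · rw [if_pos hm, if_neg (by omega), if_neg (by omega)]
  rw [if_neg hm]
  obtain ⟨m, rfl⟩ : ∃ m', m = m' + 1 := ⟨m - 1, by omega⟩
  rw [Nat.add_sub_cancel, fullSrc_vecMul_pow]
  have hW : ∀ q : LState n, snkW k n q d =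
      if (q.1 : ℕ) + 1 = d ∧ q.2.2 = q.2.1 then 1 else 0 := fun q => by
    rw [snkW, if_neg (by omega)]
  simp_rw [hW, mul_ite, mul_one, mul_zero]
  rw [Fintype.sum_prod_type]
  -- the layer index must be `m = d - 1`
  have h1 : ∀ i : Fin (n + 1), ∑ σ : Fin (n + 2) × Fin (n + 2),
      (if (i : ℕ) + 1 = d ∧ σ.2 = σ.1 then layerVec k n m (svVec k n (m + 1)) (i, σ) else 0) =
        if (i : ℕ) = m then
          (if m + 1 = (d : ℕ) then ∑ t : Fin (n + 2), sv k (n + 2) (m + 1) t t else 0)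
        else 0 := by
    intro i
    by_cases hi : (i : ℕ) = m
    · rw [if_pos hi]
      by_cases hmd : m + 1 = (d : ℕ)
      · rw [if_pos hmd, Fintype.sum_prod_type]
        refine Finset.sum_congr rfl fun t _ => ?_
        rw [Finset.sum_ite, Finset.sum_const_zero, add_zero]
        have hf : (Finset.univ.filter fun u : Fin (n + 2) => (i : ℕ) + 1 = d ∧ (t, u).2 = (t, u).1) =
            {t} := by
          ext u
          simp only [Finset.mem_filter, Finset.mem_univ, true_and, Finset.mem_singleton]
          constructor
          · exact fun h => h.2
          · intro h; exact ⟨by omega, h⟩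
        rw [hf, Finset.sum_singleton]
        simp [IL17.layerVec, svVec, hi]
      · rw [if_neg hmd]
        refine Finset.sum_eq_zero fun σ _ => ?_
        rw [if_neg (by omega)]
    · rw [if_neg hi]
      refine Finset.sum_eq_zero fun σ _ => ?_
      split_ifs with h
      · simp [IL17.layerVec, hi]
      · rfl
  rw [Finset.sum_congr rfl fun i _ => h1 i, sum_fin_val_eq']
  by_cases hmd : m + 1 = (d : ℕ)
  · have hm' : m < n + 1 := by omega
    rw [if_pos hm', if_pos hmd, if_pos hmd,
      GKKP2011.sum_univ_sv_diag_eq_coeff (by omega) (by omega), hmd]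
  · rw [if_neg (Ne.symm (fun h => hmd h.symm)), ]
    split_ifs <;> rfl

/-- **The last sink** receives, at step `n + 2`, the value of the determinant program's surviving
state `sv N (N−1) (N−1) = [λ⁰] χ_X` (`N = n + 2`), and nothing otherwise.
[cite: MahajanVinay1999, Thm. 3.2 (p0005.txt:L20–27), `c_N`] -/
theorem sinkIn_last (m : ℕ) (d : Fin (n + 3)) (hd : (d : ℕ) = n + 2) :
    sinkIn k n m d = if m = n + 1 then (chi k (n + 2) (n + 2)).coeff 0 else 0 := by
  unfold sinkIn
  by_cases hm : m = 0
  · rw [if_pos hm, if_neg (by omega), if_neg (by omega)]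
  rw [if_neg hm]
  obtain ⟨m, rfl⟩ : ∃ m', m = m' + 1 := ⟨m - 1, by omega⟩
  rw [Nat.add_sub_cancel, fullSrc_vecMul_pow]
  have hW : ∀ q : LState n, snkW k n q d = fullSnk k n q := fun q => by
    rw [snkW, if_pos hd]
  simp_rw [hW]
  rw [layerVec_svVec_dotProduct_fullSnk]
  have hsv : sv k (n + 2) (n + 2) (n + 1) (n + 1) = (chi k (n + 2) (n + 2)).coeff 0 := by
    rw [(sv_spec (k := k) (n := n + 2) (n + 2)).2.1 (n + 1), e_of_lt (show n + 1 < n + 2 by omega),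
      sub_zero]
    unfold GKKP2011.e
    rw [if_pos le_rfl, Nat.sub_self]
  rw [hsv]
  by_cases h : m = n
  · rw [if_pos h, if_pos (by omega)]
  · rw [if_neg h, if_neg (by omega)]

/-- **`(A^P)_{source, snk d} = [λ^{N−d}] χ_X` for every `P ≥ n + 2` and every `d ≤ N = n + 2`**
(generic matrix `X = (X_{ij})_{i,j<N}`): one power of the program's adjacency matrix exhibits
every coefficient of the characteristic polynomial `χ_X(λ) = det(λI − X)` — the printed `c_d` sits
at the sink `d`. [cite: MahajanVinay1999, Thm. 3.2 (p0005.txt:L20–27) and §3.1 (p0006.txt:L11–47)] -/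
theorem mvCharAdjGen_pow_src_snk (P : ℕ) (hP : n + 2 ≤ P) (d : Fin (n + 3)) :
    (mvCharAdjGen k n ^ P) (src n) (snk n d) =
      (Matrix.mvPolynomialX (Fin (n + 2)) (Fin (n + 2)) k).charpoly.coeff (n + 2 - d) := by
  rw [mvCharAdjGen_pow_src, ← genBlock_self]
  change ∑ j ∈ range P, sinkIn k n j d = (chi k (n + 2) (n + 2)).coeff (n + 2 - d)
  have hd3 := d.isLt
  by_cases hd0 : (d : ℕ) = 0
  · simp_rw [sinkIn_zero_right _ d hd0]
    rw [Finset.sum_ite_eq', if_pos (Finset.mem_range.2 (by omega)), hd0, Nat.sub_zero]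
    -- `χ` is monic of degree `N`
    nontriviality MvPolynomial (Fin (n + 2) × Fin (n + 2)) k
    have h := (Matrix.charpoly_monic (genBlock k (n + 2) (n + 2))).coeff_natDegree
    rw [Matrix.charpoly_natDegree_eq_dim, Fintype.card_fin] at h
    exact h.symm
  by_cases hdN : (d : ℕ) = n + 2
  · simp_rw [sinkIn_last _ d hdN]
    rw [Finset.sum_ite_eq', if_pos (Finset.mem_range.2 (by omega)), hdN, Nat.sub_self]
  · simp_rw [sinkIn_mid_range _ d (by omega) (by omega)]
    rw [Finset.sum_ite_eq', if_pos (Finset.mem_range.2 (by omega))]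

end Program

/-! ## Part B. Specialising the generic program to an arbitrary matrix -/

section Specialise

variable {R : Type u} [CommRing R] {n : ℕ}

open CState

/-- **The adjacency matrix of the all-coefficients Mahajan–Vinay program for the matrix `M`.**
[cite: MahajanVinay1999, Thm. 3.2 and §3.1 (p0005.txt:L20–27, p0006.txt:L11–47)] -/
def mvCharAdj (M : Matrix (Fin (n + 2)) (Fin (n + 2)) R) : Matrix (CState n) (CState n) R :=
  (mvCharAdjGen R n).map (mvSpec M)

/-- **`(A^P)_{source, snk d} = M.charpoly.coeff (n + 2 − d)`** for the program of `M`, every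
`P ≥ n + 2` and every `d ≤ n + 2`: ALL coefficients of `χ_M(λ) = det(λI − M)` are entries of ONE
power of ONE explicit matrix (the printed `c_d` at the sink `d`).
[cite: MahajanVinay1999, Thm. 3.2 (p0005.txt:L20–27) and §3.1 (p0006.txt:L11–47)] -/
theorem mvCharAdj_pow_src_snk (M : Matrix (Fin (n + 2)) (Fin (n + 2)) R) {P : ℕ} (hP : n + 2 ≤ P)
    (d : Fin (n + 3)) :
    (mvCharAdj M ^ P) (src n) (snk n d) = M.charpoly.coeff (n + 2 - d) := by
  rw [mvCharAdj, ← Matrix.map_pow, Matrix.map_apply, mvCharAdjGen_pow_src_snk P hP,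
    ← Polynomial.coeff_map, ← Matrix.charpoly_map, ← RingHom.mapMatrix_apply, mvSpec,
    Matrix.mvPolynomialX_mapMatrix_eval]

/-- In particular the last sink carries `c_N = χ_M(0) = (−1)^N det M` (`N = n + 2`).
[cite: MahajanVinay1999, Thm. 3.2 (p0005.txt:L20–27), `c_n`] -/
theorem mvCharAdj_pow_src_snk_last (M : Matrix (Fin (n + 2)) (Fin (n + 2)) R) {P : ℕ}
    (hP : n + 2 ≤ P) :
    (mvCharAdj M ^ P) (src n) (snk n (Fin.last (n + 2))) = (-1) ^ (n + 2) * M.det := by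
  rw [mvCharAdj_pow_src_snk M hP, Fin.val_last, Nat.sub_self, Matrix.det_eq_sign_charpoly_coeff,
    Fintype.card_fin, ← mul_assoc, ← pow_add, ← two_mul, pow_mul, neg_one_sq, one_pow, one_mul]

/-- … and the sink `0` carries `c_0 = 1` (`χ_M` is monic of degree `N`).
[cite: MahajanVinay1999, Thm. 3.2 (p0005.txt:L20–27), `c_0`] -/
theorem mvCharAdj_pow_src_snk_zero (M : Matrix (Fin (n + 2)) (Fin (n + 2)) R) {P : ℕ}
    (hP : n + 2 ≤ P) :
    (mvCharAdj M ^ P) (src n) (snk n 0) = 1 := by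
  nontriviality R
  rw [mvCharAdj_pow_src_snk M hP, Fin.val_zero, Nat.sub_zero]
  have h := M.charpoly_monic.coeff_natDegree
  rwa [Matrix.charpoly_natDegree_eq_dim, Fintype.card_fin] at h

/-! ### The entries of the specialised program in closed form -/

variable (M : Matrix (Fin (n + 2)) (Fin (n + 2)) R)

/-- Source edges: into layer `0`, opening the first clow (weight `± M[t, u]`).
[cite: MahajanVinay1999, §3.1 (p0006.txt:L11–47)] -/
theorem mvCharAdj_src_mid (q : LState n) :
    mvCharAdj M (src n) (mid n q) =
      if (q.1 : ℕ) = 0 then selW (q.2.1 : ℕ) q.2.2 * entryN M q.2.1 q.2.2 else 0 := by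
  simp only [mvCharAdj, Matrix.map_apply, mvCharAdjGen, Matrix.of_apply, fullSrc, start₀]
  split_ifs
  · exact mvSpec_stepW M _ _ _
  · exact map_zero _

/-- Internal edges: one layer down by the transfer weight `transN` (continue the clow
`+M[u, u']`, close it `−M[u, t]`, or open the next head `t' > t` with its first edge `± M[t', u']`).
[cite: MahajanVinay1999, §3.1 (p0006.txt:L11–47)] -/
theorem mvCharAdj_mid_mid (p q : LState n) :
    mvCharAdj M (mid n p) (mid n q) =
      if (q.1 : ℕ) = p.1 + 1 then transN M p.2.1 p.2.2 q.2.1 q.2.2 else 0 := by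
  simp only [mvCharAdj, Matrix.map_apply, mvCharAdjGen, Matrix.of_apply, fullN]
  split_ifs
  · rw [mvSpec_T₀]
  · rw [map_zero]

/-- The source feeds the sink `0` (the empty clow sequence, `c_0 = 1`) and no other sink.
[cite: MahajanVinay1999, Thm. 3.2 (p0005.txt:L20–27)] -/
theorem mvCharAdj_src_snk (d : Fin (n + 3)) :
    mvCharAdj M (src n) (snk n d) = if (d : ℕ) = 0 then 1 else 0 := by
  simp only [mvCharAdj, Matrix.map_apply, mvCharAdjGen, Matrix.of_apply]
  split_ifs
  · exact map_one _
  · exact map_zero _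

/-- Sink edges: the last sink from the last layer by the closing transition into `(n+1, n+1)`;
the sink `d`, `1 ≤ d ≤ n + 1`, from the closed heads `(t, t)` of layer `d − 1` with weight `1`.
[cite: MahajanVinay1999, Thm. 3.2 and §3.1 (p0005.txt:L20–27, p0006.txt:L11–47)] -/
theorem mvCharAdj_mid_snk (p : LState n) (d : Fin (n + 3)) :
    mvCharAdj M (mid n p) (snk n d) =
      if (d : ℕ) = n + 2 then (if (p.1 : ℕ) = n then transN M p.2.1 p.2.2 (n + 1) (n + 1) else 0)
      else if (p.1 : ℕ) + 1 = d ∧ p.2.2 = p.2.1 then 1 else 0 := by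
  simp only [mvCharAdj, Matrix.map_apply, mvCharAdjGen, Matrix.of_apply, snkW, fullSnk]
  split_ifs
  · rw [mvSpec_T₀]; simp
  · rw [map_zero]
  · rw [map_one]
  · rw [map_zero]

/-- The sinks' unit self-loops (and no edges between distinct sinks).
[cite: MahajanVinay1999, §3.1 (p0006.txt:L11–47)] -/
theorem mvCharAdj_snk_snk (d d' : Fin (n + 3)) :
    mvCharAdj M (snk n d) (snk n d') = if d = d' then 1 else 0 := by
  simp only [mvCharAdj, Matrix.map_apply, mvCharAdjGen, Matrix.of_apply]
  split_ifs
  · exact map_one _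
  · exact map_zero _

/-- Nothing enters the source. [cite: MahajanVinay1999, §3.1 (p0006.txt:L11–47)] -/
theorem mvCharAdj_apply_src (x : CState n) : mvCharAdj M x (src n) = 0 := by
  rcases x with ⟨⟨⟩⟩ | ⟨p | d⟩ <;> simp [mvCharAdj, mvCharAdjGen]

/-- The sinks only loop. [cite: MahajanVinay1999, §3.1 (p0006.txt:L11–47)] -/
theorem mvCharAdj_snk_mid (d : Fin (n + 3)) (q : LState n) : mvCharAdj M (snk n d) (mid n q) = 0 := by
  simp [mvCharAdj, mvCharAdjGen]

end Specialise

end Literature.Computability.AlgebraicComplexity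

end
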